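/-
Origin: expansion seat `planner-pub-hodgecm-pv09-g4-0`, handover #5b 2026-08-18T07:27:32Z (`HOME/pub-hodgecm-pv09-g4/lean/Pv09g4/RallisCompactDomain.lean`, md5 80536dd9, 251 lines);
landed by the gen-7 packager in gate run 26 as `HodgeCM/PerL34/RallisCompactDomain.lean` (import ^import Pv[0-9]+g[0-9]+\.→import HodgeCM.PerL34. ×2).
-/
/-
HodgeCM / PerL34 publication cell — seam S3 (pub-hodgecm-pv09-g4, HANDOVER #5).
Imports: `Pv09g4.RallisHaarDomain` (HANDOVER #2) ↦ `HodgeCM.PerL34.RallisHaarDomain`,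
`Pv09g4.CompactDomain` (HANDOVER #5) ↦ `HodgeCM.PerL34.CompactDomain`.
Complete proofs, no new axioms, nothing cited.
-/
import Summits.HodgeConjecture.HodgeCM.PerL34.RallisHaarDomain
import Summits.HodgeConjecture.HodgeCM.PerL34.CompactDomain_2

/-!
# Seam S3 — ONE fundamental domain for both branches of the end theorem

The S3 end theorems come in two branches over pv09-g3's canonical Haar datum:

* the **volume branch** `PureTensor.theta_ne_zero_haar` (hypotheses `vol_ne_zero`, `vol_ne_top`),
  used by pv09-g4 `theta_ne_zero_rallis` / `exists_domain_theta_ne_zero_rallis`, where `𝓕` is a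
  genuine fundamental domain of `U(W_i)(L₀)` and the U-class binder `hN31e` is DISCHARGED
  (`N31e_haarDatum`, which needs `h𝓕 : IsFundamentalDomain jA.range 𝓕 μ` for the unfolding);
* the **compact branch** `theta_ne_zero_haarCpt` → `theta_ne_zero_local(_of_places)` →
  `theta_ne_zero_levels(_of_places)` (pv09-g3) → pv13's `SplitShells.theta_ne_zero_levels_adic_ram /
  _adic_all` END FORMS, whose binders are `(𝓕) (h𝓕c : IsCompact 𝓕) (h𝓕i : (interior 𝓕).Nonempty)`
  and `hN31e : N31e_statement μ 𝓕 …` — there `hN31e` can only be discharged if the SAME compact `𝓕`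
  is also a fundamental domain.

`CompactDomain.exists_compact_isFundamentalDomain_left` provides exactly such a set.  This file
specialises it to `Πʳ_i [G_i, B_i]` and the Haar datum and packages, for the consumers of the compact
branch, the four binders `𝓕, h𝓕c, h𝓕i, hN31e` at once:

* `isMulRightInvariant_haarDatum_μ` — the Haar datum measure is right invariant (commutativity);
* `exists_compactDomain_haarDatum` — a compact fundamental domain with non-empty interior, positive
  finite volume, for any discrete cocompact `Γ ≤ Πʳ_i [G_i, B_i]`;
* `exists_compactDomain_N31e` — `∃ 𝓕, IsCompact 𝓕 ∧ (interior 𝓕).Nonempty ∧ IsFundamentalDomain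
  jA.range 𝓕 μ ∧ N31e_statement μ 𝓕 ω φ χ′ K c` from the leaves of node N31e (as `N31e_haarDatum`);
* `exists_compactDomain_N31e_of_N31d` — the same one node up, from node N31d's print inputs
  (pv15 `N31e_of_N31d`), with the Siegel–Weil constant `c > 0` produced;
* `exists_compactDomain_theta_ne_zero_levels_of_places` — the compact-branch end theorem of pv09-g3
  (`theta_ne_zero_levels_of_places`, levels `K_T`, `K_{T′}` only) with `𝓕, h𝓕c, h𝓕i, hN31e` ALL
  discharged from "`U(W_i)(L₀)` discrete and cocompact".
-/

set_option autoImplicit false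

noncomputable section

open MeasureTheory Set RestrictedProduct Topology
open scoped RestrictedProduct InnerProductSpace ComplexConjugate

namespace HodgeCM.PerL34.PureTensor

open HodgeCM.PerL34.AdelicFactorisation HodgeCM.PerL34.RestrictedMeasure
  HodgeCM.PerL34.NoSmallSubgroups HodgeCM.PerL34.EulerFactorisation HodgeCM.PerL34.DiscreteFD

/-! ## §1 Compact fundamental domains for the Haar datum -/

section domain

variable {ι : Type} {G : ι → Type} [∀ i, CommGroup (G i)] [∀ i, TopologicalSpace (G i)]
  [∀ i, IsTopologicalGroup (G i)] [∀ i, T2Space (G i)] [∀ i, SecondCountableTopology (G i)]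
  [∀ i, MeasurableSpace (G i)] [∀ i, BorelSpace (G i)] [Countable ι]
  (B : ∀ i, Subgroup (G i)) (hBc : ∀ i, IsCompact (B i : Set (G i)))
  (hBo : ∀ i, IsOpen (B i : Set (G i))) (S₀ : Finset ι)

/-- The global Haar measure of the Haar datum is right invariant (`Πʳ_i [G_i, B_i]` is commutative). -/
instance isMulRightInvariant_haarDatum_μ : ((haarDatum B hBc hBo S₀).μ).IsMulRightInvariant :=
  isMulRightInvariant_of_comm _

/-- **Compact fundamental domain with non-empty interior** of a discrete cocompact subgroup of
`Πʳ_i [G_i, B_i]` for the Haar datum measure, of positive finite volume. -/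
theorem exists_compactDomain_haarDatum (Γ : Subgroup (Πʳ i, [G i, B i]))
    [DiscreteTopology Γ] [CompactSpace ((Πʳ i, [G i, B i]) ⧸ Γ)] :
    ∃ 𝓕 : Set (Πʳ i, [G i, B i]), IsCompact 𝓕 ∧ (interior 𝓕).Nonempty ∧ MeasurableSet 𝓕 ∧
      IsFundamentalDomain Γ 𝓕 (haarDatum B hBc hBo S₀).μ ∧
      (haarDatum B hBc hBo S₀).μ 𝓕 ≠ 0 ∧ (haarDatum B hBc hBo S₀).μ 𝓕 ≠ ⊤ := by
  haveI : Fact (∀ i, IsOpen (B i : Set (G i))) := ⟨hBo⟩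
  haveI : BorelSpace (Πʳ i, [G i, B i]) := borelSpace_rp B hBo
  haveI : LocallyCompactSpace (Πʳ i, [G i, B i]) := locallyCompactSpace_rp B hBc hBo
  haveI : Countable Γ := countable_of_discrete_rp B hBo Γ
  obtain ⟨𝓕, hc, hi, hm, hfd⟩ :=
    exists_compact_isFundamentalDomain_left' Γ (haarDatum B hBc hBo S₀).μ
  refine ⟨𝓕, hc, hi, hm, hfd, haarDatum_vol_ne_zero_of_isFundamentalDomain B hBc hBo S₀ hfd,
    haarDatum_vol_ne_top_of_closure B hBc hBo S₀ ?_⟩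
  rw [hc.isClosed.closure_eq]
  exact hc

end domain

/-! ## §2 The four binders `𝓕, h𝓕c, h𝓕i, hN31e` of the compact branch, produced together -/

section n31e

open HodgeCM.PerL34.RallisIP

variable {ι : Type} {G : ι → Type} [∀ i, CommGroup (G i)] [∀ i, TopologicalSpace (G i)]
  [∀ i, IsTopologicalGroup (G i)] [∀ i, T2Space (G i)] [∀ i, SecondCountableTopology (G i)]
  [∀ i, LocallyCompactSpace (G i)] [∀ i, MeasurableSpace (G i)] [∀ i, BorelSpace (G i)]
  [Countable ι] [DecidableEq ι]
  (B : ∀ i, Subgroup (G i)) (hBc : ∀ i, IsCompact (B i : Set (G i)))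
  (hBo : ∀ i, IsOpen (B i : Set (G i))) (S₀ : Finset ι)
  {Sp : Type} [NormedAddCommGroup Sp] [InnerProductSpace ℂ Sp]
  {L : Type*} [Field L] [StarRing L] {W : Type*} [AddCommGroup W] [Module L W]
  {H : Type*} [Group H] {h : W →ₗ⋆[L] W →ₗ[L] L} (hW : IsLine L W) (hh : Anisotropic h)
  (ιH : (Πʳ j, [G j, B j]) × (Πʳ j, [G j, B j]) →* H)
  (ω : (Πʳ j, [G j, B j]) →* (Sp ≃ₗᵢ[ℂ] Sp))
  (χV : (Πʳ j, [G j, B j]) →* ℂ) (norm_χV : ∀ a, ‖χV a‖ = 1)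
  (jA : unitary L →* Πʳ j, [G j, B j]) (hjA : Function.Injective jA)
  -- the two structural facts of the set-up: `U(W_i)(L₀)` discrete and cocompact in `U(W_i)(𝔸)`
  [DiscreteTopology (jA.range : Subgroup (Πʳ j, [G j, B j]))]
  [CompactSpace ((Πʳ j, [G j, B j]) ⧸ (jA.range : Subgroup (Πʳ j, [G j, B j])))]
  (j : isomBox h →* H) (hj : ∀ d : unitary L, j ⟨iotaSnd d, iotaSnd_mem h d⟩ = ιH (1, jA d))
  (χ : (Πʳ j, [G j, B j]) →* Circle) (hχΓ : ∀ d : unitary L, χ (jA d) = 1)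
  (hχVΓ : ∀ d : unitary L, χV (jA d) = 1)
  (φ : Sp) (fbox Eis : H → ℂ) (K : (Πʳ j, [G j, B j]) → (Πʳ j, [G j, B j]) → ℂ) (c : ℝ)
  (hbasic : ∀ h₁ h₂ : Πʳ j, [G j, B j], fbox (ιH (h₁, h₂)) = χV h₂ * inner ℂ (ω h₂ φ) (ω h₁ φ))
  (hPinv : ∀ p ∈ (stabDelta L W).subgroupOf (isomBox h), ∀ x : H, fbox (j p * x) = fbox x)
  (hEis : ∀ u u' : Πʳ j, [G j, B j], HasSum (eisTerm h j fbox hPinv (ιH (u, u')))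
    (Eis (ιH (u, u'))))
  (hKE : ∀ u u' : Πʳ j, [G j, B j], K u u' = (c : ℂ) * (χV u')⁻¹ * Eis (ιH (u, u')))
  (hφ : ‖φ‖ = 1)
  (hloc : ∀ (i : ι) (v : Sp), Continuous fun g : G i => ω (RestrictedProduct.mulSingle B i g) v)
  {T' : Finset ι} (hχT' : RestrictedProduct.boxSubgroup B T' ≤ χ.ker)
  (hlocχ : ∀ i ∈ T', Continuous fun g : G i => χ (RestrictedProduct.mulSingle B i g))
  {T : Finset ι} (hK : ∀ k ∈ RestrictedProduct.boxSubgroup B T, ω k φ = φ)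
  (hM : ∀ S : Finset ι, T ⊆ S → ∀ y : (i : ↥S) → G i,
    inner ℂ φ (ω (extendOne B S y) φ) = ∏ i : ↥S, localCoeff B ω φ i (y i))
  {S : Finset ι} {q : ι → ℕ} {chiPi nuPi : ι → ℂ} {IsSplit : ι → Prop}
  (X : UnramifiedPlaceData B (haarDatum B hBc hBo S₀) ω φ χ S q chiPi nuPi IsSplit)
  (hTS : T ⊆ S)
  (hclS : ∀ i ∈ S, Integrable (localCoeff B ω φ i) ((haarDatum B hBc hBo S₀).ν i))
  (hsum : Summable fun i : {j : ι // j ∉ S} => EulerProduct.tOf (q i.1))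

include hW hh norm_χV hjA hj hχΓ hχVΓ hbasic hEis hKE hφ hloc hχT' hlocχ hK hM X hTS hclS hsum in
/-- **`𝓕, h𝓕c, h𝓕i, hN31e` produced together.**  With `U(W_i)(L₀)` discrete and cocompact in
`U(W_i)(𝔸)` there is a COMPACT fundamental domain `𝓕` with NON-EMPTY INTERIOR (positive finite
volume) for which Rallis' formula `N31e_statement μ 𝓕 ω φ χ′ K c` HOLDS (from the leaves of node
N31e: N31c `hbasic`, N31d `hPinv`/`hEis`/`hKE`, the rational set-up, the representation-side data).
Feed `𝓕, h𝓕c, h𝓕i, hN31e` to any end theorem of the compact branch. -/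
theorem exists_compactDomain_N31e :
    ∃ 𝓕 : Set (Πʳ j, [G j, B j]), IsCompact 𝓕 ∧ (interior 𝓕).Nonempty ∧ MeasurableSet 𝓕 ∧
      IsFundamentalDomain jA.range 𝓕 (haarDatum B hBc hBo S₀).μ ∧
      (haarDatum B hBc hBo S₀).μ 𝓕 ≠ 0 ∧ (haarDatum B hBc hBo S₀).μ 𝓕 ≠ ⊤ ∧
      RallisIP.N31e_statement (haarDatum B hBc hBo S₀).μ 𝓕 ω φ (fun y => ((χ y : Circle) : ℂ)) K
        (c : ℂ) := by
  haveI : Countable (jA.range : Subgroup (Πʳ j, [G j, B j])) :=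
    countable_of_discrete_rp B hBo jA.range
  haveI : Countable (unitary L) := Countable.of_equiv _ (MonoidHom.ofInjective hjA).toEquiv.symm
  obtain ⟨𝓕, hc, hi, hm, hfd, h0, htop⟩ :=
    exists_compactDomain_haarDatum B hBc hBo S₀ (jA.range : Subgroup (Πʳ j, [G j, B j]))
  exact ⟨𝓕, hc, hi, hm, hfd, h0, htop, N31e_haarDatum B hBc hBo S₀ hW hh ιH ω χV norm_χV jA hjA j
    hj hfd χ hχΓ hχVΓ φ fbox Eis K c hbasic hPinv hEis hKE hφ hloc hχT' hlocχ hK hM X hTS hclS hsum⟩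

variable {E : Type*} [NormedAddCommGroup E] [InnerProductSpace ℂ E]

include hW hh norm_χV hjA hj hχΓ hχVΓ hbasic hEis hKE hφ hloc hχT' hlocχ hK hM X hTS hclS in
omit hsum in
/-- **The compact-branch end theorem of pv09-g3 over the finite places of `L₀`, everything on the
`𝓕`-side discharged**: `theta_ne_zero_levels_of_places` (levels `K_T`, `K_{T′}` and LOCAL continuity
only) with its binders `𝓕, h𝓕c, h𝓕i, hN31e` produced from "`U(W_i)(L₀)` discrete and cocompact" and
the leaves of node N31e. -/
theorem exists_compactDomain_theta_ne_zero_levels_of_places (hT'S : T' ⊆ S) (c_pos : 0 < c)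
    (ram_pos : ∀ i ∈ S, 0 < (localIntegrand B (haarDatum B hBc hBo S₀) ω φ χ i).I)
    (L₀ : Type*) [Field L₀] [NumberField L₀]
    (e : {j : ι // j ∉ S} → IsDedekindDomain.HeightOneSpectrum (NumberField.RingOfIntegers L₀))
    (he : Function.Injective e)
    (hq : ∀ j : {j : ι // j ∉ S}, q j.1 = Ideal.absNorm (e j).asIdeal) :
    ∃ 𝓕 : Set (Πʳ j, [G j, B j]), IsCompact 𝓕 ∧ (interior 𝓕).Nonempty ∧
      IsFundamentalDomain jA.range 𝓕 (haarDatum B hBc hBo S₀).μ ∧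
      ∀ (θ : E) (Θ : Set E), θ ∈ Θ →
        ⟪θ, θ⟫_ℂ = ∫ u in 𝓕, ∫ u' in 𝓕, ((χ u : Circle) : ℂ) * conj ((χ u' : Circle) : ℂ) *
          K u u' ∂(haarDatum B hBc hBo S₀).μ ∂(haarDatum B hBc hBo S₀).μ → θ ≠ 0 := by
  have hsum : Summable fun i : {j : ι // j ∉ S} => EulerProduct.tOf (q i.1) :=
    EulerProduct.summable_tOf_of_places L₀ e he hq
  obtain ⟨𝓕, hc, hi, -, hfd, -, -, hN31e⟩ := exists_compactDomain_N31e B hBc hBo S₀ hW hh ιH ω χV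
    norm_χV jA hjA j hj χ hχΓ hχVΓ φ fbox Eis K c hbasic hPinv hEis hKE hφ hloc hχT' hlocχ hK hM X hTS
    hclS hsum
  exact ⟨𝓕, hc, hi, hfd, fun θ Θ hθ hnorm =>
    theta_ne_zero_levels_of_places B hBc hBo S₀ ω φ hφ hloc χ hχT' hlocχ 𝓕 hc hi K c c_pos θ Θ hθ
      hN31e hnorm hK hM X hTS hT'S hclS ram_pos L₀ e he hq⟩

end n31e

/-! ## §3 One node up: from node N31d's print inputs -/

section n31d

open HodgeCM.PerL34.RallisIP HodgeCM.PerL34.Doubling HodgeCM.PerL34.N31d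

variable {ι : Type} {G : ι → Type} [∀ i, CommGroup (G i)] [∀ i, TopologicalSpace (G i)]
  [∀ i, IsTopologicalGroup (G i)] [∀ i, T2Space (G i)] [∀ i, SecondCountableTopology (G i)]
  [∀ i, LocallyCompactSpace (G i)] [∀ i, MeasurableSpace (G i)] [∀ i, BorelSpace (G i)]
  [Countable ι] [DecidableEq ι]
  (B : ∀ i, Subgroup (G i)) (hBc : ∀ i, IsCompact (B i : Set (G i)))
  (hBo : ∀ i, IsOpen (B i : Set (G i))) (S₀ : Finset ι)
  {Sp : Type} [NormedAddCommGroup Sp] [InnerProductSpace ℂ Sp]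
  {L : Type} [Field L] [StarRing L] {W : Type} [AddCommGroup W] [Module L W]
  {H Sbox : Type} [Group H] [AddCommGroup Sbox] [Module ℂ Sbox]
  {h : W →ₗ⋆[L] W →ₗ[L] L} (hW : IsLine L W) (hh : Anisotropic h)
  (D : DoublingDatum (Πʳ j, [G j, B j]) H Sp Sbox) (GU : ThetaSide Sp Sbox)
  (jA : unitary L →* Πʳ j, [G j, B j]) (hjA : Function.Injective jA)
  [DiscreteTopology (jA.range : Subgroup (Πʳ j, [G j, B j]))]
  [CompactSpace ((Πʳ j, [G j, B j]) ⧸ (jA.range : Subgroup (Πʳ j, [G j, B j])))]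
  (j : isomBox h →* H) (hj : ∀ d : unitary L, j ⟨iotaSnd d, iotaSnd_mem h d⟩ = D.ι (1, jA d))
  (χ : (Πʳ j, [G j, B j]) →* Circle) (hχΓ : ∀ d : unitary L, χ (jA d) = 1)
  (hχVΓ : ∀ d : unitary L, D.χV (jA d) = 1)
  {hP : ∀ Ψ : Sbox, ∀ p ∈ (stabDelta L W).subgroupOf (isomBox h), ∀ x : H,
    D.fSW Ψ (j p * x) = D.fSW Ψ x}
  (P : GluePrintInputs D GU h j hP) (φ : Sp)
  (hφ : ‖φ‖ = 1)
  (hloc : ∀ (i : ι) (v : Sp), Continuous fun g : G i => D.ω (RestrictedProduct.mulSingle B i g) v)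
  {T' : Finset ι} (hχT' : RestrictedProduct.boxSubgroup B T' ≤ χ.ker)
  (hlocχ : ∀ i ∈ T', Continuous fun g : G i => χ (RestrictedProduct.mulSingle B i g))
  {T : Finset ι} (hK : ∀ k ∈ RestrictedProduct.boxSubgroup B T, D.ω k φ = φ)
  (hM : ∀ S : Finset ι, T ⊆ S → ∀ y : (i : ↥S) → G i,
    inner ℂ φ (D.ω (extendOne B S y) φ) = ∏ i : ↥S, localCoeff B D.ω φ i (y i))
  {S : Finset ι} {q : ι → ℕ} {chiPi nuPi : ι → ℂ} {IsSplit : ι → Prop}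
  (X : UnramifiedPlaceData B (haarDatum B hBc hBo S₀) D.ω φ χ S q chiPi nuPi IsSplit)
  (hTS : T ⊆ S)
  (hclS : ∀ i ∈ S, Integrable (localCoeff B D.ω φ i) ((haarDatum B hBc hBo S₀).ν i))
  (hsum : Summable fun i : {j : ι // j ∉ S} => EulerProduct.tOf (q i.1))

include hW hh hjA hj hχΓ hχVΓ P hφ hloc hχT' hlocχ hK hM X hTS hclS hsum in
/-- **`c, c_pos, 𝓕, h𝓕c, h𝓕i, hN31e` produced together from node N31d** (pv15 `N31e_of_N31d`: the
Siegel–Weil constant, summability of the Eisenstein series and the theta-kernel identity), for the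
THETA KERNEL `K = thetaKernel D GU φ`. -/
theorem exists_compactDomain_N31e_of_N31d :
    ∃ (c : ℝ) (𝓕 : Set (Πʳ j, [G j, B j])), 0 < c ∧ IsCompact 𝓕 ∧ (interior 𝓕).Nonempty ∧
      MeasurableSet 𝓕 ∧ IsFundamentalDomain jA.range 𝓕 (haarDatum B hBc hBo S₀).μ ∧
      (haarDatum B hBc hBo S₀).μ 𝓕 ≠ 0 ∧ (haarDatum B hBc hBo S₀).μ 𝓕 ≠ ⊤ ∧
      RallisIP.N31e_statement (haarDatum B hBc hBo S₀).μ 𝓕 D.ω φ (fun y => ((χ y : Circle) : ℂ))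
        (thetaKernel D GU φ) (c : ℂ) := by
  haveI : Fact (∀ i, IsOpen (B i : Set (G i))) := ⟨hBo⟩
  haveI : BorelSpace (Πʳ i, [G i, B i]) := borelSpace_rp B hBo
  haveI : MeasurableMul₂ (Πʳ i, [G i, B i]) := measurableMul₂_rp B hBo
  haveI : MeasurableInv (Πʳ i, [G i, B i]) := measurableInv_rp B hBo
  haveI : Countable (jA.range : Subgroup (Πʳ j, [G j, B j])) :=
    countable_of_discrete_rp B hBo jA.range
  haveI : Countable (unitary L) := Countable.of_equiv _ (MonoidHom.ofInjective hjA).toEquiv.symm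
  have hχ : Continuous χ := continuous_char B hBo χ hχT' hlocχ
  obtain ⟨𝓕, hc, hi, hm, hfd, h0, htop⟩ :=
    exists_compactDomain_haarDatum B hBc hBo S₀ (jA.range : Subgroup (Πʳ j, [G j, B j]))
  obtain ⟨c, c_pos, hN31e⟩ := N31e_of_N31d hW hh (haarDatum B hBc hBo S₀).μ jA hjA hj hfd
    (fun y => ((χ y : Circle) : ℂ))
    (isAutChar_coe χ jA.range (by rintro _ ⟨d, rfl⟩; exact hχΓ d))
    (continuous_subtype_val.comp hχ).measurable hχVΓ P φ
    (integrable_coeff_haarDatum B hBc hBo S₀ D.ω φ hφ hloc χ hχT' hlocχ hK hM X hTS hclS hsum)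
  exact ⟨c, 𝓕, c_pos, hc, hi, hm, hfd, h0, htop, hN31e⟩

end n31d

end HodgeCM.PerL34.PureTensor

end
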